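import Mathlib
import Summits.ValiantsHypothesis.ValiantsHypothesis.Theorems.KPlusLogSqLawWeakLiftingTowerGraftSkewBlockCrossings
import Summits.ValiantsHypothesis.ValiantsHypothesis.Theorems.KPlusLogSqLawWeakLiftingTowerGraftFoldLawAxisPair

/-!
# Tower graft line — THE SKEW-BLOCK FAMILY WITH THE INDEFINITE AXIS-PAIR GRAFT CROSSES TWICE AT EVERY DOMINATED ROOT (no-go side of T3,
# the crossing mechanism)

Calibration file for the line `Cruxes/WeakLifting/Lines/tower_graft.lean` (crux `WeakLifting` = stmt-ValiantsHypothesis-19561), memo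
`Lines/tower_graft-S5.md` §1/§3 T3/§18; the NO-GO companion of the fold law `…TowerGraftFoldLawAxisPair.lean` (p709692).  NO stub is claimed.

Far letter: the INDEFINITE axis pair `S = E_{inr j} − E_{inr i}` at two indices of the negative block of the skew-block letters (p688917).
* `skewBlock_add_axisPair`, `det_skewBlock_add_axisPair` — SCHUR with the pair:
  `det(G + g·S) = c^p (−c⁻¹)^{q+1} · det(c²·1 + BᵀB + cg·Eᵢᵢ − cg·Eⱼⱼ)` (`c = η t^{d_{l₀}}`).
* `submatrix_sq_smul_one_add_map`, `neg_one_pow_succ_mul_skewFactor_pos` — bookkeeping.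
* ★ `skewBlock_axisPair_crossings` — for blocks `B(t)` of shape `p × (q+1)` and interleaved positive points `τ₀ < ρ₀ < ⋯ < ρ_{N−1} < τ_N` with
  `B(τᵣ)ᵀB(τᵣ)` non-singular, `B(ρᵣ)ᵀB(ρᵣ)` singular and the `i`-deleted Gram minor STRICTLY BELOW the `j`-deleted one at every `ρᵣ`
  (`= κ·(uᵢ² < uⱼ²)` for the kernel vector `u` at a corank-one point), some `η > 0` makes `det(G_η + X^D·S)` have `≥ 2N` distinct positive roots,
  for EVERY exponent `D`.  Mechanism: the crossing polynomial in `η` at fixed `t` is `det M + η t^{d+D}(adj Mᵢᵢ − adj Mⱼⱼ) − η²(…)·ε(M)`,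
  `M = η²t^{2d}·1 + BᵀB` (digits from p709692 `det_add_smul_single_sub_smul_single`); constant coefficient `det(BᵀB)`, linear coefficient
  `t^{d+D}·(Gramᵢ − Gramⱼ)`; sign persistence + IVT certificate as in p689545.

READING: with `…AxisPairEvents` (all four event polynomials of the fold-law file are ROOTLESS for this family) and `…AxisPairSharp` (Θ(m²) such
crossings from the Descartes-sharp `(k,3)` family by a two-scale mixing), «PHANTOMS ARE NOT A FOLD PHENOMENON»: the rank-two indefinite graft
has its events class-paid (p709692) AND instance-empty events pay nothing — the NO-GO ledger's standing consequence (§17.2) extends to S5's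
object at rank two.  HONEST FRAMING: nothing on S4/S4b/S5/S5ᴸ, TowerB, `WeakLifting`, Conjecture B, `MatrixDescartes` (18050) or `VP ≠ VNP`.
Def-free.  Seat: prover val-sym-lift-p2 g21, `--supports stmt-ValiantsHypothesis-19561`.
-/

-- `Summit.ValiantsHypothesis.ValiantsHypothesis.…` repeats a component by the D-0017 layout
-- (single-conjunct summit), which the `dupNamespace` linter flags; the name is mandated.
set_option linter.dupNamespace false

namespace Summit.ValiantsHypothesis.ValiantsHypothesis.Theorems.KPlusLogSqLaw.TowerGraft

open Polynomial Matrix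
open scoped BigOperators Polynomial

section AxisPairCrossings

variable {p q : ℕ}

/-- the axis pair at two indices of the second block only touches the lower-right block. [folklore] -/
theorem skewBlock_add_axisPair (c g : ℝ) (B : Matrix (Fin p) (Fin (q + 1)) ℝ) (i j : Fin (q + 1)) :
    Matrix.fromBlocks (c • (1 : Matrix (Fin p) (Fin p) ℝ)) B Bᵀ (-(c • (1 : Matrix (Fin (q + 1)) (Fin (q + 1)) ℝ))) +
        g • (Matrix.single (Sum.inr j : Fin p ⊕ Fin (q + 1)) (Sum.inr j) (1 : ℝ) -
          Matrix.single (Sum.inr i : Fin p ⊕ Fin (q + 1)) (Sum.inr i) (1 : ℝ)) =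
      Matrix.fromBlocks (c • (1 : Matrix (Fin p) (Fin p) ℝ)) B Bᵀ
        (-(c • (1 : Matrix (Fin (q + 1)) (Fin (q + 1)) ℝ)) + g • Matrix.single j j (1 : ℝ) - g • Matrix.single i i (1 : ℝ)) := by
  ext (a | a) (b | b) <;> simp [Matrix.fromBlocks, Matrix.single_apply, smul_sub]
  abel

/-- **SCHUR WITH THE AXIS PAIR**: `det ([[c·1, B],[Bᵀ, −c·1]] + g·(E_{inr j} − E_{inr i})) = c^p (−c⁻¹)^{q+1} · det(c²·1 + BᵀB + cg·Eᵢᵢ − cg·Eⱼⱼ)`.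
[this work] -/
theorem det_skewBlock_add_axisPair (c : ℝ) (hc : c ≠ 0) (g : ℝ) (B : Matrix (Fin p) (Fin (q + 1)) ℝ) (i j : Fin (q + 1)) :
    (Matrix.fromBlocks (c • (1 : Matrix (Fin p) (Fin p) ℝ)) B Bᵀ (-(c • (1 : Matrix (Fin (q + 1)) (Fin (q + 1)) ℝ))) +
        g • (Matrix.single (Sum.inr j : Fin p ⊕ Fin (q + 1)) (Sum.inr j) (1 : ℝ) -
          Matrix.single (Sum.inr i : Fin p ⊕ Fin (q + 1)) (Sum.inr i) (1 : ℝ))).det =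
      c ^ p * (-c⁻¹) ^ (q + 1) *
        (c ^ 2 • (1 : Matrix (Fin (q + 1)) (Fin (q + 1)) ℝ) + Bᵀ * B + (c * g) • Matrix.single i i (1 : ℝ) -
          (c * g) • Matrix.single j j (1 : ℝ)).det := by
  rw [skewBlock_add_axisPair]
  haveI : Invertible (c • (1 : Matrix (Fin p) (Fin p) ℝ)) :=
    invertibleOfLeftInverse _ (c⁻¹ • (1 : Matrix (Fin p) (Fin p) ℝ)) (by
      rw [smul_mul_smul_comm, Matrix.one_mul, inv_mul_cancel₀ hc, one_smul])
  have hinv : ⅟(c • (1 : Matrix (Fin p) (Fin p) ℝ)) = c⁻¹ • (1 : Matrix (Fin p) (Fin p) ℝ) :=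
    invOf_eq_left_inv (by rw [smul_mul_smul_comm, Matrix.one_mul, inv_mul_cancel₀ hc, one_smul])
  rw [Matrix.det_fromBlocks₁₁, hinv, Matrix.det_smul, Matrix.det_one, mul_one, Fintype.card_fin]
  have hS : -(c • (1 : Matrix (Fin (q + 1)) (Fin (q + 1)) ℝ)) + g • Matrix.single j j (1 : ℝ) - g • Matrix.single i i (1 : ℝ) -
        Bᵀ * (c⁻¹ • (1 : Matrix (Fin p) (Fin p) ℝ)) * B =
      (-c⁻¹) • (c ^ 2 • (1 : Matrix (Fin (q + 1)) (Fin (q + 1)) ℝ) + Bᵀ * B + (c * g) • Matrix.single i i (1 : ℝ) -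
          (c * g) • Matrix.single j j (1 : ℝ)) := by
    rw [Matrix.mul_smul, Matrix.mul_one, Matrix.smul_mul]
    ext a b
    simp only [Matrix.add_apply, Matrix.sub_apply, Matrix.neg_apply, Matrix.smul_apply, Matrix.one_apply, Matrix.single_apply,
      smul_eq_mul]
    split_ifs <;> field_simp <;> ring
  rw [hS, Matrix.det_smul, Fintype.card_fin]
  ring

/-- a principal minor of the polynomial matrix `(c₀X²)·1 + M` for `M = BᵀB`: `(c₀X²)·1 + B″ᵀB″`. [folklore] -/
theorem submatrix_sq_smul_one_add_map (c₀ : ℝ) (B : Matrix (Fin p) (Fin (q + 1)) ℝ) (k : Fin (q + 1)) :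
    ((C c₀ * X ^ 2) • (1 : Matrix (Fin (q + 1)) (Fin (q + 1)) ℝ[X]) + (Bᵀ * B).map C).submatrix k.succAbove k.succAbove =
      (C c₀ * X ^ 2) • (1 : Matrix (Fin q) (Fin q) ℝ[X]) + ((B.submatrix id k.succAbove)ᵀ * B.submatrix id k.succAbove).map C := by
  ext a b
  simp [Matrix.submatrix_apply, Matrix.mul_apply, Matrix.one_apply, Fin.succAbove_right_injective.eq_iff]

/-- the sign factor `c^p·(−c⁻¹)^{q+1}` has the sign `(−1)^{q+1}` for `c > 0`. [folklore] -/
theorem neg_one_pow_succ_mul_skewFactor_pos {c : ℝ} (hc : 0 < c) (p q : ℕ) :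
    0 < (-1 : ℝ) ^ (q + 1) * (c ^ p * (-c⁻¹) ^ (q + 1)) := by
  have h := neg_one_pow_mul_skewFactor_pos hc p q
  have e : (-1 : ℝ) ^ (q + 1) * (c ^ p * (-c⁻¹) ^ (q + 1)) = (-1 : ℝ) ^ q * (c ^ p * (-c⁻¹) ^ q * c⁻¹) := by ring
  rw [e]; exact h

/-- **THE SKEW-BLOCK FAMILY WITH THE INDEFINITE AXIS-PAIR GRAFT CROSSES TWICE AT EVERY ROOT OF `det B` WHERE THE `j`-DELETED GRAM
MINOR DOMINATES THE `i`-DELETED ONE.**  Skew-block letters on any support; far letter `E_{inr j} − E_{inr i}` (rank two, signature `(1,1)`,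
both indices in the negative block); `B(t) = Σₗ t^{dₗ}Bₗ` of shape `p × (q+1)`.  If positive points `τ₀ < ρ₀ < τ₁ < ⋯ < ρ_{N−1} < τ_N` satisfy:
`B(τᵣ)ᵀB(τᵣ)` non-singular, `B(ρᵣ)ᵀB(ρᵣ)` singular and `det(B″ᵢ(ρᵣ)ᵀB″ᵢ(ρᵣ)) < det(B″ⱼ(ρᵣ)ᵀB″ⱼ(ρᵣ))` (`B″ₖ = B` minus column `k`; at a
corank-one point `adj(BᵀB) = κ·uuᵀ`, so this reads `uᵢ² < uⱼ²` for the kernel vector `u`), then for some `η > 0` the graft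
`det(G_η + X^D·(E_{inr j} − E_{inr i}))` has at least `2N` distinct positive roots (every exponent `D`). [this work] -/
theorem skewBlock_axisPair_crossings {K : ℕ} (d : Fin K → ℕ) (l₀ : Fin K) (D : ℕ) (B : Fin K → Matrix (Fin p) (Fin (q + 1)) ℝ)
    {i j : Fin (q + 1)} (hij : i ≠ j) (N : ℕ) (τ ρ : ℕ → ℝ) (hτρ : ∀ r, τ r < ρ r) (hρτ : ∀ r, ρ r < τ (r + 1)) (hτpos : ∀ r, 0 < τ r)
    (hτB : ∀ r, r ≤ N → ((∑ l, τ r ^ d l • B l)ᵀ * (∑ l, τ r ^ d l • B l)).det ≠ 0)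
    (hρB : ∀ r, r < N → ((∑ l, ρ r ^ d l • B l)ᵀ * (∑ l, ρ r ^ d l • B l)).det = 0)
    (hρB'' : ∀ r, r < N → (((∑ l, ρ r ^ d l • B l).submatrix id i.succAbove)ᵀ * ((∑ l, ρ r ^ d l • B l).submatrix id i.succAbove)).det <
      (((∑ l, ρ r ^ d l • B l).submatrix id j.succAbove)ᵀ * ((∑ l, ρ r ^ d l • B l).submatrix id j.succAbove)).det) :
    ∃ η : ℝ, 0 < η ∧ 2 * N ≤
      ((((∑ l, (X : ℝ[X]) ^ d l • (Matrix.fromBlocks (if l = l₀ then η • (1 : Matrix (Fin p) (Fin p) ℝ) else 0) (B l) (B l)ᵀ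
          (if l = l₀ then -(η • (1 : Matrix (Fin (q + 1)) (Fin (q + 1)) ℝ)) else 0)).map C) +
        (X : ℝ[X]) ^ D • (Matrix.single (Sum.inr j : Fin p ⊕ Fin (q + 1)) (Sum.inr j) (1 : ℝ[X]) -
          Matrix.single (Sum.inr i : Fin p ⊕ Fin (q + 1)) (Sum.inr i) (1 : ℝ[X]))).det).roots.toFinset.filter
        (fun t => 0 < t)).card := by
  classical
  set Bt : ℝ → Matrix (Fin p) (Fin (q + 1)) ℝ := fun t => ∑ l, t ^ d l • B l with hBt
  -- the polynomial matrix `M_t(η) = (t^{2d} η²)·1 + BᵀB` and the crossing polynomial in `η`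
  set Mt : ℝ → Matrix (Fin (q + 1)) (Fin (q + 1)) ℝ[X] := fun t =>
    (C ((t ^ d l₀) ^ 2) * X ^ 2) • (1 : Matrix (Fin (q + 1)) (Fin (q + 1)) ℝ[X]) + ((Bt t)ᵀ * Bt t).map C with hMt
  set Φ : ℝ → ℝ[X] := fun t =>
    (Mt t).det + X * C (t ^ d l₀ * t ^ D) * ((Mt t).adjugate i i - (Mt t).adjugate j j) -
      X ^ 2 * C ((t ^ d l₀ * t ^ D) ^ 2) * (((Mt t).updateRow i (Pi.single i 1)).updateRow j (Pi.single j 1)).det with hΦ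
  have hadj : ∀ t (k : Fin (q + 1)), ((Mt t).adjugate k k).coeff 0 =
      (((Bt t).submatrix id k.succAbove)ᵀ * (Bt t).submatrix id k.succAbove).det := by
    intro t k
    rw [adjugate_apply_self_eq_det_submatrix, hMt]
    simp only
    rw [submatrix_sq_smul_one_add_map, coeff_zero_det_sq_smul_one_add]
  have hΦ0 : ∀ t, (Φ t).coeff 0 = ((Bt t)ᵀ * Bt t).det := fun t => by
    simp only [hΦ, coeff_sub, coeff_add, mul_assoc, coeff_X_mul_zero, coeff_X_pow_mul', hMt, coeff_zero_det_sq_smul_one_add]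
    simp
  have hΦ1 : ∀ t, (Φ t).coeff 1 = t ^ d l₀ * t ^ D * ((((Bt t).submatrix id i.succAbove)ᵀ * (Bt t).submatrix id i.succAbove).det -
      (((Bt t).submatrix id j.succAbove)ᵀ * (Bt t).submatrix id j.succAbove).det) := fun t => by
    have h1 : ((Mt t).det).coeff 1 = 0 := by rw [hMt]; exact coeff_one_det_sq_smul_one_add _ _
    simp only [hΦ, coeff_sub, coeff_add, mul_assoc, coeff_X_mul, coeff_C_mul, coeff_X_pow_mul', h1, coeff_sub, hadj]
    simp
  -- the graft at `(η, t)` is a fixed-sign multiple of `(Φ t).eval η`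
  have hgraft : ∀ η t : ℝ, 0 < η → 0 < t →
      (((∑ l, (X : ℝ[X]) ^ d l • (Matrix.fromBlocks (if l = l₀ then η • (1 : Matrix (Fin p) (Fin p) ℝ) else 0) (B l) (B l)ᵀ
          (if l = l₀ then -(η • (1 : Matrix (Fin (q + 1)) (Fin (q + 1)) ℝ)) else 0)).map C) +
        (X : ℝ[X]) ^ D • (Matrix.single (Sum.inr j : Fin p ⊕ Fin (q + 1)) (Sum.inr j) (1 : ℝ[X]) -
          Matrix.single (Sum.inr i : Fin p ⊕ Fin (q + 1)) (Sum.inr i) (1 : ℝ[X]))).det).eval t =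
      ((η * t ^ d l₀) ^ p * (-(η * t ^ d l₀)⁻¹) ^ (q + 1)) * (Φ t).eval η := by
    intro η t hη ht
    have hc : η * t ^ d l₀ ≠ 0 := mul_ne_zero hη.ne' (pow_ne_zero _ ht.ne')
    have hev : (((∑ l, (X : ℝ[X]) ^ d l • (Matrix.fromBlocks (if l = l₀ then η • (1 : Matrix (Fin p) (Fin p) ℝ) else 0) (B l) (B l)ᵀ
          (if l = l₀ then -(η • (1 : Matrix (Fin (q + 1)) (Fin (q + 1)) ℝ)) else 0)).map C) +
        (X : ℝ[X]) ^ D • (Matrix.single (Sum.inr j : Fin p ⊕ Fin (q + 1)) (Sum.inr j) (1 : ℝ[X]) -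
          Matrix.single (Sum.inr i : Fin p ⊕ Fin (q + 1)) (Sum.inr i) (1 : ℝ[X]))).det).eval t =
        ((∑ l, t ^ d l • Matrix.fromBlocks (if l = l₀ then η • (1 : Matrix (Fin p) (Fin p) ℝ) else 0) (B l) (B l)ᵀ
          (if l = l₀ then -(η • (1 : Matrix (Fin (q + 1)) (Fin (q + 1)) ℝ)) else 0)) +
          t ^ D • (Matrix.single (Sum.inr j : Fin p ⊕ Fin (q + 1)) (Sum.inr j) (1 : ℝ) -
            Matrix.single (Sum.inr i : Fin p ⊕ Fin (q + 1)) (Sum.inr i) (1 : ℝ))).det := by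
      have h := RingHom.map_det (Polynomial.evalRingHom t)
        ((∑ l, (X : ℝ[X]) ^ d l • (Matrix.fromBlocks (if l = l₀ then η • (1 : Matrix (Fin p) (Fin p) ℝ) else 0) (B l) (B l)ᵀ
          (if l = l₀ then -(η • (1 : Matrix (Fin (q + 1)) (Fin (q + 1)) ℝ)) else 0)).map C) +
        (X : ℝ[X]) ^ D • (Matrix.single (Sum.inr j : Fin p ⊕ Fin (q + 1)) (Sum.inr j) (1 : ℝ[X]) -
          Matrix.single (Sum.inr i : Fin p ⊕ Fin (q + 1)) (Sum.inr i) (1 : ℝ[X])))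
      rw [Polynomial.coe_evalRingHom] at h
      rw [h]
      congr 1
      ext a b
      simp only [RingHom.mapMatrix_apply, Matrix.map_apply, Matrix.add_apply, Matrix.sub_apply, Matrix.smul_apply, Matrix.sum_apply,
        Polynomial.coe_evalRingHom, Polynomial.eval_add, Polynomial.eval_sub, Polynomial.eval_finsetSum, smul_eq_mul, Polynomial.eval_mul,
        Polynomial.eval_pow, Polynomial.eval_X, Polynomial.eval_C, Matrix.single_apply]
      congr 1
      split_ifs <;> simp
    rw [hev, skewBlock_pencil_eval, det_skewBlock_add_axisPair _ hc, det_add_smul_single_sub_smul_single _ hij]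
    have hM : ∀ t η : ℝ, ((Mt t).map (eval η)) = ((η * t ^ d l₀) ^ 2 • (1 : Matrix (Fin (q + 1)) (Fin (q + 1)) ℝ) + (Bt t)ᵀ * Bt t) := by
      intro t η
      ext a b
      simp only [hMt, Matrix.map_apply, Matrix.add_apply, Matrix.smul_apply, Matrix.one_apply, smul_eq_mul, mul_ite, mul_one, mul_zero,
        eval_add, eval_C]
      split_ifs <;> simp; ring
    have e1 : (Φ t).eval η = ((η * t ^ d l₀) ^ 2 • (1 : Matrix (Fin (q + 1)) (Fin (q + 1)) ℝ) + (Bt t)ᵀ * Bt t).det +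
        η * (t ^ d l₀ * t ^ D) * ((((η * t ^ d l₀) ^ 2 • (1 : Matrix (Fin (q + 1)) (Fin (q + 1)) ℝ) + (Bt t)ᵀ * Bt t).adjugate i i) -
          (((η * t ^ d l₀) ^ 2 • (1 : Matrix (Fin (q + 1)) (Fin (q + 1)) ℝ) + (Bt t)ᵀ * Bt t).adjugate j j)) -
        η ^ 2 * (t ^ d l₀ * t ^ D) ^ 2 *
          ((((η * t ^ d l₀) ^ 2 • (1 : Matrix (Fin (q + 1)) (Fin (q + 1)) ℝ) + (Bt t)ᵀ * Bt t).updateRow i (Pi.single i 1)).updateRow j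
            (Pi.single j 1)).det := by
      rw [← hM t η]
      have hd : ((Mt t).map (eval η)).det = ((Mt t).det).eval η := by
        rw [← Polynomial.coe_evalRingHom, ← RingHom.mapMatrix_apply, ← RingHom.map_det]
      have ha : ∀ k, ((Mt t).map (eval η)).adjugate k k = ((Mt t).adjugate k k).eval η := by
        intro k
        rw [← Polynomial.coe_evalRingHom, ← RingHom.mapMatrix_apply, ← RingHom.map_adjugate, RingHom.mapMatrix_apply, Matrix.map_apply]
      have hu : (((Mt t).map (eval η)).updateRow i (Pi.single i 1)).updateRow j (Pi.single j 1) =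
          ((((Mt t).updateRow i (Pi.single i 1)).updateRow j (Pi.single j 1))).map (eval η) := by
        ext a b
        simp only [Matrix.map_apply, Matrix.updateRow_apply, Pi.single_apply]
        split_ifs <;> simp
      rw [hd, ha, ha, hu, ← Polynomial.coe_evalRingHom, ← RingHom.mapMatrix_apply, ← RingHom.map_det]
      simp only [hΦ, Polynomial.coe_evalRingHom, eval_sub, eval_add, eval_mul, eval_pow, eval_X, eval_C]
    rw [e1, hBt]
    simp only
    ring
  -- thresholds at the `τ`'s (positive) and the `ρ`'s (negative)
  have Hτ : ∀ r, ∃ η₀ : ℝ, 0 < η₀ ∧ (r ≤ N → ∀ η, 0 < η → η < η₀ → 0 < (Φ (τ r)).eval η) := by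
    intro r
    by_cases hr : r ≤ N
    · have h0 : (-(Φ (τ r))).eval 0 < 0 := by
        rw [eval_neg, ← coeff_zero_eq_eval_zero, hΦ0]
        have hpsd := (posSemidef_transpose_mul_self (Bt (τ r))).det_nonneg
        have hne := hτB r hr
        exact neg_neg_of_pos (lt_of_le_of_ne hpsd (Ne.symm hne))
      obtain ⟨η₀, h1, h2⟩ := exists_pos_forall_eval_neg _ h0
      exact ⟨η₀, h1, fun _ η hη hηη => by have := h2 η hη hηη; rw [eval_neg] at this; linarith⟩
    · exact ⟨1, one_pos, fun h => absurd h hr⟩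
  have Hρ : ∀ r, ∃ η₀ : ℝ, 0 < η₀ ∧ (r < N → ∀ η, 0 < η → η < η₀ → (Φ (ρ r)).eval η < 0) := by
    intro r
    by_cases hr : r < N
    · have h0 : (-(Φ (ρ r))).coeff 0 = 0 := by rw [coeff_neg, hΦ0, hρB r hr, neg_zero]
      have h1 : 0 < (-(Φ (ρ r))).coeff 1 := by
        rw [coeff_neg, hΦ1]
        have hρpos : 0 < ρ r := (hτpos r).trans (hτρ r)
        have hlt := hρB'' r hr
        have hpos : 0 < ρ r ^ d l₀ * ρ r ^ D := mul_pos (pow_pos hρpos _) (pow_pos hρpos _)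
        nlinarith
      obtain ⟨η₀, h2, h3⟩ := exists_pos_forall_eval_pos_of_coeff _ h0 h1
      exact ⟨η₀, h2, fun _ η hη hηη => by have := h3 η hη hηη; rw [eval_neg] at this; linarith⟩
    · exact ⟨1, one_pos, fun h => absurd h hr⟩
  choose ητ hητ hτpos' using Hτ
  choose ηρ hηρ hρneg using Hρ
  set Sη : Finset ℝ := (Finset.range (N + 1)).image ητ ∪ (Finset.range N).image ηρ with hSη
  have hSne : Sη.Nonempty := ⟨ητ 0, Finset.mem_union_left _ (Finset.mem_image.mpr ⟨0, Finset.mem_range.mpr (Nat.succ_pos N), rfl⟩)⟩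
  set η₁ := Sη.min' hSne with hη₁
  have hη₁pos : 0 < η₁ := by
    rw [hη₁, Finset.lt_min'_iff]
    intro y hy
    rcases Finset.mem_union.mp hy with hy | hy
    · obtain ⟨r, -, rfl⟩ := Finset.mem_image.mp hy; exact hητ r
    · obtain ⟨r, -, rfl⟩ := Finset.mem_image.mp hy; exact hηρ r
  have hη₁τ : ∀ r, r ≤ N → η₁ ≤ ητ r := fun r hr =>
    Finset.min'_le _ _ (Finset.mem_union_left _ (Finset.mem_image.mpr ⟨r, Finset.mem_range.mpr (Nat.lt_succ_of_le hr), rfl⟩))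
  have hη₁ρ : ∀ r, r < N → η₁ ≤ ηρ r := fun r hr =>
    Finset.min'_le _ _ (Finset.mem_union_right _ (Finset.mem_image.mpr ⟨r, Finset.mem_range.mpr hr, rfl⟩))
  set η := η₁ / 2 with hη
  have hηpos : 0 < η := by rw [hη]; positivity
  have hηlt : η < η₁ := by rw [hη]; linarith
  refine ⟨η, hηpos, ?_⟩
  have hposτ : ∀ r, r ≤ N → 0 < (Φ (τ r)).eval η := fun r hr => hτpos' r hr η hηpos (hηlt.trans_le (hη₁τ r hr))
  have hnegρ : ∀ r, r < N → (Φ (ρ r)).eval η < 0 := fun r hr => hρneg r hr η hηpos (hηlt.trans_le (hη₁ρ r hr))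
  set h : ℝ[X] := (((∑ l, (X : ℝ[X]) ^ d l • (Matrix.fromBlocks (if l = l₀ then η • (1 : Matrix (Fin p) (Fin p) ℝ) else 0) (B l) (B l)ᵀ
          (if l = l₀ then -(η • (1 : Matrix (Fin (q + 1)) (Fin (q + 1)) ℝ)) else 0)).map C) +
        (X : ℝ[X]) ^ D • (Matrix.single (Sum.inr j : Fin p ⊕ Fin (q + 1)) (Sum.inr j) (1 : ℝ[X]) -
          Matrix.single (Sum.inr i : Fin p ⊕ Fin (q + 1)) (Sum.inr i) (1 : ℝ[X]))).det) with hh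
  have hprod : ∀ t₁ t₂ : ℝ, 0 < t₁ → 0 < t₂ → (Φ t₁).eval η * (Φ t₂).eval η < 0 → h.eval t₁ * h.eval t₂ < 0 := by
    intro t₁ t₂ ht₁ ht₂ hlt
    rw [hh, hgraft η t₁ hηpos ht₁, hgraft η t₂ hηpos ht₂]
    have k1 := neg_one_pow_succ_mul_skewFactor_pos (mul_pos hηpos (pow_pos ht₁ (d l₀))) p q
    have k2 := neg_one_pow_succ_mul_skewFactor_pos (mul_pos hηpos (pow_pos ht₂ (d l₀))) p q
    have hsq : ((-1 : ℝ) ^ (q + 1)) * ((-1 : ℝ) ^ (q + 1)) = 1 := by rw [← mul_pow, neg_one_mul, neg_neg, one_pow]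
    have key : ((η * t₁ ^ d l₀) ^ p * (-(η * t₁ ^ d l₀)⁻¹) ^ (q + 1) * (Φ t₁).eval η) *
        ((η * t₂ ^ d l₀) ^ p * (-(η * t₂ ^ d l₀)⁻¹) ^ (q + 1) * (Φ t₂).eval η) =
        (((-1 : ℝ) ^ (q + 1) * ((η * t₁ ^ d l₀) ^ p * (-(η * t₁ ^ d l₀)⁻¹) ^ (q + 1))) *
          ((-1 : ℝ) ^ (q + 1) * ((η * t₂ ^ d l₀) ^ p * (-(η * t₂ ^ d l₀)⁻¹) ^ (q + 1)))) *
          ((Φ t₁).eval η * (Φ t₂).eval η) := by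
      have : ((-1 : ℝ) ^ (q + 1) * ((η * t₁ ^ d l₀) ^ p * (-(η * t₁ ^ d l₀)⁻¹) ^ (q + 1))) *
          ((-1 : ℝ) ^ (q + 1) * ((η * t₂ ^ d l₀) ^ p * (-(η * t₂ ^ d l₀)⁻¹) ^ (q + 1))) =
          (((-1 : ℝ) ^ (q + 1)) * ((-1 : ℝ) ^ (q + 1))) * (((η * t₁ ^ d l₀) ^ p * (-(η * t₁ ^ d l₀)⁻¹) ^ (q + 1)) *
            ((η * t₂ ^ d l₀) ^ p * (-(η * t₂ ^ d l₀)⁻¹) ^ (q + 1))) := by ring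
      rw [this, hsq, one_mul]; ring
    rw [key]
    exact mul_neg_of_pos_of_neg (mul_pos k1 k2) hlt
  -- the interleaved certificate
  set f : ℕ → ℝ := fun n => if n % 2 = 0 then τ (n / 2) else ρ (n / 2) with hf
  have hf_even : ∀ n : ℕ, n % 2 = 0 → f n = τ (n / 2) := fun n hn => by simp only [hf, if_pos hn]
  have hf_odd : ∀ n : ℕ, ¬ n % 2 = 0 → f n = ρ (n / 2) := fun n hn => by simp only [hf, if_neg hn]
  have hf_succ : ∀ n : ℕ, f n < f (n + 1) := by
    intro n
    by_cases hn : n % 2 = 0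
    · rw [hf_even n hn, hf_odd (n + 1) (by omega), show (n + 1) / 2 = n / 2 by omega]; exact hτρ _
    · rw [hf_odd n hn, hf_even (n + 1) (by omega), show (n + 1) / 2 = n / 2 + 1 by omega]; exact hρτ _
  have hf_mono : StrictMono f := strictMono_nat_of_lt_succ hf_succ
  have hf_pos : ∀ n, 0 < f n := by
    intro n
    by_cases hn : n % 2 = 0
    · rw [hf_even n hn]; exact hτpos _
    · rw [hf_odd n hn]; exact (hτpos _).trans (hτρ _)
  have hf_alt : ∀ n : ℕ, n + 1 ≤ 2 * N → h.eval (f n) * h.eval (f (n + 1)) < 0 := by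
    intro n hn
    refine hprod _ _ (hf_pos n) (hf_pos (n + 1)) ?_
    by_cases hpar : n % 2 = 0
    · rw [hf_even n hpar, hf_odd (n + 1) (by omega), show (n + 1) / 2 = n / 2 by omega]
      exact mul_neg_of_pos_of_neg (hposτ _ (by omega)) (hnegρ _ (by omega))
    · rw [hf_odd n hpar, hf_even (n + 1) (by omega), show (n + 1) / 2 = n / 2 + 1 by omega]
      exact mul_neg_of_neg_of_pos (hnegρ _ (by omega)) (hposτ _ (by omega))
  have hcnt := Summit.ValiantsHypothesis.ValiantsHypothesis.Theorems.SymmetroidDescartes.le_card_posRoots_of_alternating h (2 * N)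
    (fun r => f (r : ℕ)) (fun a b hab => hf_mono hab) (fun r => hf_pos r) (fun r => by
      have e1 : ((Fin.castSucc r : Fin (2 * N + 1)) : ℕ) = (r : ℕ) := rfl
      have e2 : ((Fin.succ r : Fin (2 * N + 1)) : ℕ) = (r : ℕ) + 1 := rfl
      simp only [e1, e2]
      exact hf_alt r (by omega))
  simpa [hh] using hcnt

end AxisPairCrossings

end Summit.ValiantsHypothesis.ValiantsHypothesis.Theorems.KPlusLogSqLaw.TowerGraft
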